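import Mathlib
import Literature.Probability.Percolation.SharpnessDCTProofs
import HarnessLib

/-!
# Open paths of the axial skeleton are chains of fully open coarse edges

Helper file for the stub `stub_boundaryValues` of the line `Sketch` (crux
`stmt-CriticalPhenomena-10269`, `…Theses.CardySelfRefinement.GradientComparability`), boundary
value `c = 0` of the self-refinement model `M_k(ρ, c)`: there only *axial* edges of `ℤ²` can be
open (horizontal edges on rows `k ∣ y`, vertical edges on columns `k ∣ x`: the coarse lattice
`kℤ²` with every edge subdivided into `k` sub-edges).  A skeleton vertex is a *coarse vertex*
(both coordinates multiples of `k`) or an interior point of a coarse edge (degree `2`), so an open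
walk runs straight between consecutive visits of coarse vertices, and reaching a *new* coarse
vertex uses a *fully open* coarse edge.  `skeleton_reach` is this invariant of open walks;
`skeleton_arm` extracts from a walk of `sup`-displacement `≥ k(L + 2)` an open path of length
`≥ L + 1` (sup norm) in any coarse configuration `Φ` containing the fully open coarse edges,
started at a coarse vertex within `k - 1` of the start of the walk.
-/

noncomputable section

namespace Summit.CriticalPhenomena.CardyFormulaZ2.Theorems.CardySelfRefinement

open Set
open Literature.Probability.LatticeModels Literature.Probability.Percolation

/-! ## Arithmetic of multiples of `k` -/

/-- A multiple of `k > 0` within `k` of `kC` is `kC - k`, `kC` or `kC + k`. -/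
theorem eq_of_dvd_near {k C x : ℤ} (hk : 0 < k) (hx : k ∣ x) (h1 : k * C - k ≤ x)
    (h2 : x ≤ k * C + k) : x = k * C - k ∨ x = k * C ∨ x = k * C + k := by
  obtain ⟨q, rfl⟩ := hx
  have h3 : C - 1 ≤ q := le_of_mul_le_mul_left (by linarith) hk
  have h4 : q ≤ C + 1 := le_of_mul_le_mul_left (by linarith) hk
  rcases (show q = C - 1 ∨ q = C ∨ q = C + 1 by omega) with rfl | rfl | rfl
  · left; ring
  · right; left; rfl
  · right; right; ring

/-- No multiple of `k` lies strictly between `kC` and `kC + k`. -/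
theorem not_dvd_of_between {k C x : ℤ} (hk : 0 < k) (h1 : k * C < x) (h2 : x < k * C + k) :
    ¬ k ∣ x := fun hx => by
  rcases eq_of_dvd_near hk hx (by linarith) h2.le with h | h | h <;> omega

/-- `kC ± 1` is not a multiple of `k ≥ 2`. -/
theorem not_dvd_of_adjacent {k C x : ℤ} (hk : 2 ≤ k) (h : x = k * C + 1 ∨ x = k * C - 1) :
    ¬ k ∣ x := fun hx => by
  rcases eq_of_dvd_near (C := C) (by linarith) hx (by omega) (by omega) with h' | h' | h' <;> omega

/-- Division with remainder: `k (x / k) ≤ x < k (x / k) + k`. -/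
theorem ediv_bounds {k : ℤ} (hk : 0 < k) (x : ℤ) : k * (x / k) ≤ x ∧ x < k * (x / k) + k := by
  have h1 := Int.mul_ediv_add_emod x k
  have h2 := Int.emod_nonneg x hk.ne'
  have h3 := Int.emod_lt_of_pos x hk
  constructor <;> linarith

/-! ## One step of an open walk in the skeleton -/

/-- **One step in the skeleton.**  If every edge of `ω` is an axial nearest-neighbour edge, an
open edge `{a, b}` is a unit horizontal step on a row `k ∣ y` or a unit vertical step on a
column `k ∣ x`. -/
theorem skeleton_step {k : ℕ} {ω : BondConfig (Site 2)}
    (hω : ∀ e ∈ ω, ∃ (v : Site 2) (d : Fin 2),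
      e = s(v, v + (if d = 0 then ![1, 0] else ![0, 1])) ∧ (k : ℤ) ∣ v (if d = 0 then 1 else 0))
    {a b : Site 2} (hab : s(a, b) ∈ ω) :
    ((b 0 = a 0 + 1 ∨ b 0 = a 0 - 1) ∧ b 1 = a 1 ∧ (k : ℤ) ∣ a 1) ∨
      ((b 1 = a 1 + 1 ∨ b 1 = a 1 - 1) ∧ b 0 = a 0 ∧ (k : ℤ) ∣ a 0) := by
  obtain ⟨v, d, he, hax⟩ := hω _ hab
  rw [Sym2.eq_iff] at he
  fin_cases d
  · simp only [Fin.zero_eta, Fin.isValue, ↓reduceIte] at he hax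
    left
    rcases he with ⟨rfl, rfl⟩ | ⟨rfl, rfl⟩
    · simpa using hax
    · refine ⟨Or.inr ?_, ?_, ?_⟩ <;> simp [hax]
  · simp only [Fin.mk_one, Fin.isValue, one_ne_zero, ↓reduceIte] at he hax
    right
    rcases he with ⟨rfl, rfl⟩ | ⟨rfl, rfl⟩
    · simpa using hax
    · refine ⟨Or.inr ?_, ?_, ?_⟩ <;> simp [hax]

/-- A unit horizontal open step, rewritten as a sub-edge of its row. -/
theorem hedge_of_step {ω : BondConfig (Site 2)} {b c : Site 2} (hbc : s(b, c) ∈ ω)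
    (h1 : c 1 = b 1) (h0 : c 0 = b 0 + 1 ∨ c 0 = b 0 - 1) :
    s((![min (b 0) (c 0), b 1] : Site 2), ![min (b 0) (c 0) + 1, b 1]) ∈ ω := by
  rcases h0 with h0 | h0
  · have hb : b = ![min (b 0) (c 0), b 1] := by ext j; fin_cases j <;> simp [h0]
    have hc : c = ![min (b 0) (c 0) + 1, b 1] := by ext j; fin_cases j <;> simp [h0, h1]
    rwa [← hb, ← hc]
  · have hc : c = ![min (b 0) (c 0), b 1] := by ext j; fin_cases j <;> simp [h0, h1]
    have hb : b = ![min (b 0) (c 0) + 1, b 1] := by ext j; fin_cases j <;> simp [h0]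
    rw [← hb, ← hc, Sym2.eq_swap]
    exact hbc

/-- A unit vertical open step, rewritten as a sub-edge of its column. -/
theorem vedge_of_step {ω : BondConfig (Site 2)} {b c : Site 2} (hbc : s(b, c) ∈ ω)
    (h0 : c 0 = b 0) (h1 : c 1 = b 1 + 1 ∨ c 1 = b 1 - 1) :
    s((![b 0, min (b 1) (c 1)] : Site 2), ![b 0, min (b 1) (c 1) + 1]) ∈ ω := by
  rcases h1 with h1 | h1
  · have hb : b = ![b 0, min (b 1) (c 1)] := by ext j; fin_cases j <;> simp [h1]
    have hc : c = ![b 0, min (b 1) (c 1) + 1] := by ext j; fin_cases j <;> simp [h0, h1]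
    rwa [← hb, ← hc]
  · have hc : c = ![b 0, min (b 1) (c 1)] := by ext j; fin_cases j <;> simp [h0, h1]
    have hb : b = ![b 0, min (b 1) (c 1) + 1] := by ext j; fin_cases j <;> simp [h1]
    rw [← hb, ← hc, Sym2.eq_swap]
    exact hbc

/-! ## The invariant of open skeleton walks -/

/-- **Open skeleton walks.**  Let every edge of `ω` be axial (`k ≥ 2`) and let `Φ` be a
configuration of the coarse lattice containing the coarse edge `{C, C + e_d}` whenever its `k`
sub-edges `{kC + i e_d, kC + (i+1) e_d}`, `0 ≤ i < k`, are all in `ω`.  If `u` and `w` are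
joined by an open walk, then either the walk is trivial at a non-coarse vertex, or `u` and `w`
are interior points of one coarse edge, or there are coarse indices `C`, `C'` with `kC` within
`k - 1` of `u` (both coordinates), `C` joined to `C'` by a `Φ`-open path, and `w` on an open
straight run of length `≤ k - 1` issued from `kC'`. -/
theorem skeleton_reach {k : ℕ} (hk : 2 ≤ k) {ω : BondConfig (Site 2)}
    (hω : ∀ e ∈ ω, ∃ (v : Site 2) (d : Fin 2),
      e = s(v, v + (if d = 0 then ![1, 0] else ![0, 1])) ∧ (k : ℤ) ∣ v (if d = 0 then 1 else 0))
    (Φ : BondConfig (Site 2))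
    (hΦh : ∀ C : Site 2, (∀ i : ℤ, (k : ℤ) * C 0 ≤ i → i < (k : ℤ) * C 0 + k →
        s((![i, (k : ℤ) * C 1] : Site 2), ![i + 1, (k : ℤ) * C 1]) ∈ ω) → s(C, C + ![1, 0]) ∈ Φ)
    (hΦv : ∀ C : Site 2, (∀ i : ℤ, (k : ℤ) * C 1 ≤ i → i < (k : ℤ) * C 1 + k →
        s((![(k : ℤ) * C 0, i] : Site 2), ![(k : ℤ) * C 0, i + 1]) ∈ ω) → s(C, C + ![0, 1]) ∈ Φ)
    {u w : Site 2} (h : (openGraph ω).Reachable u w) :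
    (u = w ∧ ¬ ((k : ℤ) ∣ u 0 ∧ (k : ℤ) ∣ u 1)) ∨
    (∃ C : Site 2,
      (u 1 = k * C 1 ∧ w 1 = k * C 1 ∧ (k : ℤ) * C 0 < u 0 ∧ u 0 < k * C 0 + k ∧
          (k : ℤ) * C 0 < w 0 ∧ w 0 < k * C 0 + k) ∨
      (u 0 = k * C 0 ∧ w 0 = k * C 0 ∧ (k : ℤ) * C 1 < u 1 ∧ u 1 < k * C 1 + k ∧
          (k : ℤ) * C 1 < w 1 ∧ w 1 < k * C 1 + k)) ∨
    (∃ C C' : Site 2, ((k : ℤ) * C 0 - k < u 0 ∧ u 0 < k * C 0 + k ∧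
        (k : ℤ) * C 1 - k < u 1 ∧ u 1 < k * C 1 + k) ∧
      PathIn (openGraph Φ) univ C C' ∧
      ((w 1 = k * C' 1 ∧ ((k : ℤ) * C' 0 - k < w 0 ∧ w 0 < k * C' 0 + k) ∧
          ∀ i : ℤ, min ((k : ℤ) * C' 0) (w 0) ≤ i → i < max ((k : ℤ) * C' 0) (w 0) →
            s((![i, (k : ℤ) * C' 1] : Site 2), ![i + 1, (k : ℤ) * C' 1]) ∈ ω) ∨
       (w 0 = k * C' 0 ∧ ((k : ℤ) * C' 1 - k < w 1 ∧ w 1 < k * C' 1 + k) ∧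
          ∀ i : ℤ, min ((k : ℤ) * C' 1) (w 1) ≤ i → i < max ((k : ℤ) * C' 1) (w 1) →
            s((![(k : ℤ) * C' 0, i] : Site 2), ![(k : ℤ) * C' 0, i + 1]) ∈ ω))) := by
  have hk0 : (0 : ℤ) < k := by exact_mod_cast (show 0 < k by omega)
  have hk2 : (2 : ℤ) ≤ k := by exact_mod_cast hk
  -- adjacency in the coarse graph from full coarse edges
  have hadjh : ∀ C : Site 2, (∀ i : ℤ, (k : ℤ) * C 0 ≤ i → i < (k : ℤ) * C 0 + k →
      s((![i, (k : ℤ) * C 1] : Site 2), ![i + 1, (k : ℤ) * C 1]) ∈ ω) →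
      (openGraph Φ).Adj C ![C 0 + 1, C 1] := fun C hC => by
    have e : C + ![1, 0] = ![C 0 + 1, C 1] := by ext j; fin_cases j <;> simp
    refine (openGraph_adj Φ _ _).2 ⟨e ▸ hΦh C hC, fun h' => ?_⟩
    have := congrFun h' 0; simp at this
  have hadjv : ∀ C : Site 2, (∀ i : ℤ, (k : ℤ) * C 1 ≤ i → i < (k : ℤ) * C 1 + k →
      s((![(k : ℤ) * C 0, i] : Site 2), ![(k : ℤ) * C 0, i + 1]) ∈ ω) →
      (openGraph Φ).Adj C ![C 0, C 1 + 1] := fun C hC => by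
    have e : C + ![0, 1] = ![C 0, C 1 + 1] := by ext j; fin_cases j <;> simp
    refine (openGraph_adj Φ _ _).2 ⟨e ▸ hΦv C hC, fun h' => ?_⟩
    have := congrFun h' 1; simp at this
  rw [SimpleGraph.reachable_iff_reflTransGen] at h
  induction h with
  | refl =>
    by_cases hu : (k : ℤ) ∣ u 0 ∧ (k : ℤ) ∣ u 1
    · obtain ⟨⟨q0, hq0⟩, ⟨q1, hq1⟩⟩ := hu
      refine Or.inr (Or.inr ⟨![q0, q1], ![q0, q1], ?_, PathIn.refl (mem_univ _),
        Or.inl ⟨?_, ?_, fun i hi1 hi2 => ?_⟩⟩) <;>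
        simp only [Matrix.cons_val_zero, Matrix.cons_val_one, Matrix.cons_val_fin_one] at * <;> omega
    · exact Or.inl ⟨rfl, hu⟩
  | @tail b c _ hbc ih =>
    have hbc' : s(b, c) ∈ ω := ((openGraph_adj ω b c).1 hbc).1
    have hstep := skeleton_step hω hbc'
    rcases ih with ⟨rfl, hu⟩ | ⟨C, hC⟩ | ⟨C, C', hCu, hpath, hseg⟩
    · ----------------------------------------------------------------- trivial walk at `u`
      rcases hstep with ⟨h0, h1, hdiv⟩ | ⟨h1, h0, hdiv⟩
      · -- horizontal step
        have hu0 : ¬ (k : ℤ) ∣ u 0 := fun h => hu ⟨h, hdiv⟩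
        obtain ⟨q1, hq1⟩ := hdiv
        by_cases hc0 : (k : ℤ) ∣ c 0
        · obtain ⟨q0, hq0⟩ := hc0
          refine Or.inr (Or.inr ⟨![q0, q1], ![q0, q1], ?_, PathIn.refl (mem_univ _),
            Or.inl ⟨?_, ?_, fun i hi1 hi2 => ?_⟩⟩) <;>
            simp only [Matrix.cons_val_zero, Matrix.cons_val_one, Matrix.cons_val_fin_one] at * <;> omega
        · have hb := ediv_bounds hk0 (u 0)
          have hne1 : u 0 ≠ k * (u 0 / k) := fun h => hu0 ⟨_, h⟩
          have hne2 : c 0 ≠ k * (u 0 / k) := fun h => hc0 ⟨_, h⟩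
          have hne3 : c 0 ≠ k * (u 0 / k) + k := fun h => hc0 ⟨u 0 / k + 1, by rw [h]; ring⟩
          refine Or.inr (Or.inl ⟨![u 0 / k, q1], Or.inl ?_⟩)
          simp only [Matrix.cons_val_zero, Matrix.cons_val_one, Matrix.cons_val_fin_one]
          omega
      · -- vertical step
        have hu1 : ¬ (k : ℤ) ∣ u 1 := fun h => hu ⟨hdiv, h⟩
        obtain ⟨q0, hq0⟩ := hdiv
        by_cases hc1 : (k : ℤ) ∣ c 1
        · obtain ⟨q1, hq1⟩ := hc1
          refine Or.inr (Or.inr ⟨![q0, q1], ![q0, q1], ?_, PathIn.refl (mem_univ _),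
            Or.inr ⟨?_, ?_, fun i hi1 hi2 => ?_⟩⟩) <;>
            simp only [Matrix.cons_val_zero, Matrix.cons_val_one, Matrix.cons_val_fin_one] at * <;> omega
        · have hb := ediv_bounds hk0 (u 1)
          have hne1 : u 1 ≠ k * (u 1 / k) := fun h => hu1 ⟨_, h⟩
          have hne2 : c 1 ≠ k * (u 1 / k) := fun h => hc1 ⟨_, h⟩
          have hne3 : c 1 ≠ k * (u 1 / k) + k := fun h => hc1 ⟨u 1 / k + 1, by rw [h]; ring⟩
          refine Or.inr (Or.inl ⟨![q0, u 1 / k], Or.inr ?_⟩)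
          simp only [Matrix.cons_val_zero, Matrix.cons_val_one, Matrix.cons_val_fin_one]
          omega
    · ----------------------------------------------------------------- inside one coarse edge
      rcases hC with ⟨hu1, hb1, hu0a, hu0b, hb0a, hb0b⟩ | ⟨hu0, hb0, hu1a, hu1b, hb1a, hb1b⟩
      · -- horizontal coarse edge
        rcases hstep with ⟨h0, h1, -⟩ | ⟨-, -, hdiv⟩
        · by_cases hc0 : (k : ℤ) ∣ c 0
          · have hc0' := eq_of_dvd_near (C := C 0) hk0 hc0 (by omega) (by omega)
            obtain ⟨q0, hq0⟩ := hc0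
            refine Or.inr (Or.inr ⟨![q0, C 1], ![q0, C 1], ?_, PathIn.refl (mem_univ _),
              Or.inl ⟨?_, ?_, fun i hi1 hi2 => ?_⟩⟩) <;>
              simp only [Matrix.cons_val_zero, Matrix.cons_val_one, Matrix.cons_val_fin_one] at * <;> omega
          · have hne2 : c 0 ≠ k * C 0 := fun h => hc0 ⟨_, h⟩
            have hne3 : c 0 ≠ k * C 0 + k := fun h => hc0 ⟨C 0 + 1, by rw [h]; ring⟩
            refine Or.inr (Or.inl ⟨C, Or.inl ⟨hu1, by omega, hu0a, hu0b, ?_, ?_⟩⟩) <;> omega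
        · exact absurd hdiv (not_dvd_of_between hk0 hb0a hb0b)
      · -- vertical coarse edge
        rcases hstep with ⟨-, -, hdiv⟩ | ⟨h1, h0, -⟩
        · exact absurd hdiv (not_dvd_of_between hk0 hb1a hb1b)
        · by_cases hc1 : (k : ℤ) ∣ c 1
          · have hc1' := eq_of_dvd_near (C := C 1) hk0 hc1 (by omega) (by omega)
            obtain ⟨q1, hq1⟩ := hc1
            refine Or.inr (Or.inr ⟨![C 0, q1], ![C 0, q1], ?_, PathIn.refl (mem_univ _),
              Or.inr ⟨?_, ?_, fun i hi1 hi2 => ?_⟩⟩) <;>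
              simp only [Matrix.cons_val_zero, Matrix.cons_val_one, Matrix.cons_val_fin_one] at * <;> omega
          · have hne2 : c 1 ≠ k * C 1 := fun h => hc1 ⟨_, h⟩
            have hne3 : c 1 ≠ k * C 1 + k := fun h => hc1 ⟨C 1 + 1, by rw [h]; ring⟩
            refine Or.inr (Or.inl ⟨C, Or.inr ⟨hu0, by omega, hu1a, hu1b, ?_, ?_⟩⟩) <;> omega
    · ----------------------------------------------------------------- anchored walk
      rcases hseg with ⟨hb1, hb0, hedges⟩ | ⟨hb0, hb1, hedges⟩
      · -- `b` on a horizontal run from `kC'`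
        rcases hstep with ⟨h0, h1, -⟩ | ⟨h1, h0, hdiv⟩
        · -- horizontal step
          have hnew := hedge_of_step hbc' h1 h0
          rw [hb1] at hnew
          by_cases hc0 : (k : ℤ) ∣ c 0
          · rcases eq_of_dvd_near (C := C' 0) hk0 hc0 (by omega) (by omega) with hc | hc | hc
            · -- new coarse vertex `k(C' - e₀)`
              have hfull : ∀ i : ℤ, (k : ℤ) * (![C' 0 - 1, C' 1] : Site 2) 0 ≤ i →
                  i < (k : ℤ) * (![C' 0 - 1, C' 1] : Site 2) 0 + k →
                  s((![i, (k : ℤ) * (![C' 0 - 1, C' 1] : Site 2) 1] : Site 2),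
                    ![i + 1, (k : ℤ) * (![C' 0 - 1, C' 1] : Site 2) 1]) ∈ ω := by
                intro i hi1 hi2
                simp only [Matrix.cons_val_zero, Matrix.cons_val_one, Matrix.cons_val_fin_one,
                  mul_sub, mul_one] at hi1 hi2 ⊢
                by_cases hi : i = min (b 0) (c 0)
                · rw [hi]; exact hnew
                · exact hedges i (by omega) (by omega)
              have hadj := hadjh _ hfull
              have e : (![(![C' 0 - 1, C' 1] : Site 2) 0 + 1, (![C' 0 - 1, C' 1] : Site 2) 1] :
                  Site 2) = C' := by
                ext j; fin_cases j <;> simp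
              rw [e] at hadj
              refine Or.inr (Or.inr ⟨C, ![C' 0 - 1, C' 1], hCu, hpath.tail hadj.symm (mem_univ _),
                Or.inl ⟨?_, ?_, fun i hi1 hi2 => ?_⟩⟩) <;>
                simp only [Matrix.cons_val_zero, Matrix.cons_val_one, Matrix.cons_val_fin_one, mul_sub, mul_one] at * <;> omega
            · -- back at `kC'`
              refine Or.inr (Or.inr ⟨C, C', hCu, hpath, Or.inl ⟨by omega, by omega,
                fun i hi1 hi2 => ?_⟩⟩)
              omega
            · -- new coarse vertex `k(C' + e₀)`
              have hfull : ∀ i : ℤ, (k : ℤ) * C' 0 ≤ i → i < (k : ℤ) * C' 0 + k →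
                  s((![i, (k : ℤ) * C' 1] : Site 2), ![i + 1, (k : ℤ) * C' 1]) ∈ ω := by
                intro i hi1 hi2
                by_cases hi : i = min (b 0) (c 0)
                · rw [hi]; exact hnew
                · exact hedges i (by omega) (by omega)
              refine Or.inr (Or.inr ⟨C, ![C' 0 + 1, C' 1], hCu,
                hpath.tail (hadjh C' hfull) (mem_univ _), Or.inl ⟨?_, ?_, fun i hi1 hi2 => ?_⟩⟩) <;>
                simp only [Matrix.cons_val_zero, Matrix.cons_val_one, Matrix.cons_val_fin_one, mul_add, mul_one] at * <;> omega
          · -- interior point of a coarse edge at `kC'`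
            have hne1 : c 0 ≠ k * C' 0 + k := fun h => hc0 ⟨C' 0 + 1, by rw [h]; ring⟩
            have hne2 : c 0 ≠ k * C' 0 - k := fun h => hc0 ⟨C' 0 - 1, by rw [h]; ring⟩
            refine Or.inr (Or.inr ⟨C, C', hCu, hpath, Or.inl ⟨by omega, by omega,
              fun i hi1 hi2 => ?_⟩⟩)
            by_cases hi : i = min (b 0) (c 0)
            · rw [hi]; exact hnew
            · exact hedges i (by omega) (by omega)
        · -- vertical step: only possible at `kC'` itself
          have hb0' : b 0 = k * C' 0 := by
            rcases eq_of_dvd_near (C := C' 0) hk0 hdiv (by omega) (by omega) with h | h | h <;>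
              omega
          have hnew := vedge_of_step hbc' h0 h1
          rw [hb0'] at hnew
          refine Or.inr (Or.inr ⟨C, C', hCu, hpath, Or.inr ⟨by omega, by omega,
            fun i hi1 hi2 => ?_⟩⟩)
          have hi : i = min (b 1) (c 1) := by omega
          rw [hi]; exact hnew
      · -- `b` on a vertical run from `kC'`
        rcases hstep with ⟨h0, h1, hdiv⟩ | ⟨h1, h0, -⟩
        · -- horizontal step: only possible at `kC'` itself
          have hb1' : b 1 = k * C' 1 := by
            rcases eq_of_dvd_near (C := C' 1) hk0 hdiv (by omega) (by omega) with h | h | h <;>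
              omega
          have hnew := hedge_of_step hbc' h1 h0
          rw [hb1'] at hnew
          refine Or.inr (Or.inr ⟨C, C', hCu, hpath, Or.inl ⟨by omega, by omega,
            fun i hi1 hi2 => ?_⟩⟩)
          have hi : i = min (b 0) (c 0) := by omega
          rw [hi]; exact hnew
        · -- vertical step
          have hnew := vedge_of_step hbc' h0 h1
          rw [hb0] at hnew
          by_cases hc1 : (k : ℤ) ∣ c 1
          · rcases eq_of_dvd_near (C := C' 1) hk0 hc1 (by omega) (by omega) with hc | hc | hc
            · -- new coarse vertex `k(C' - e₁)`
              have hfull : ∀ i : ℤ, (k : ℤ) * (![C' 0, C' 1 - 1] : Site 2) 1 ≤ i →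
                  i < (k : ℤ) * (![C' 0, C' 1 - 1] : Site 2) 1 + k →
                  s((![(k : ℤ) * (![C' 0, C' 1 - 1] : Site 2) 0, i] : Site 2),
                    ![(k : ℤ) * (![C' 0, C' 1 - 1] : Site 2) 0, i + 1]) ∈ ω := by
                intro i hi1 hi2
                simp only [Matrix.cons_val_zero, Matrix.cons_val_one, Matrix.cons_val_fin_one,
                  mul_sub, mul_one] at hi1 hi2 ⊢
                by_cases hi : i = min (b 1) (c 1)
                · rw [hi]; exact hnew
                · exact hedges i (by omega) (by omega)
              have hadj := hadjv _ hfull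
              have e : (![(![C' 0, C' 1 - 1] : Site 2) 0, (![C' 0, C' 1 - 1] : Site 2) 1 + 1] :
                  Site 2) = C' := by
                ext j; fin_cases j <;> simp
              rw [e] at hadj
              refine Or.inr (Or.inr ⟨C, ![C' 0, C' 1 - 1], hCu, hpath.tail hadj.symm (mem_univ _),
                Or.inr ⟨?_, ?_, fun i hi1 hi2 => ?_⟩⟩) <;>
                simp only [Matrix.cons_val_zero, Matrix.cons_val_one, Matrix.cons_val_fin_one, mul_sub, mul_one] at * <;> omega
            · -- back at `kC'`
              refine Or.inr (Or.inr ⟨C, C', hCu, hpath, Or.inr ⟨by omega, by omega,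
                fun i hi1 hi2 => ?_⟩⟩)
              omega
            · -- new coarse vertex `k(C' + e₁)`
              have hfull : ∀ i : ℤ, (k : ℤ) * C' 1 ≤ i → i < (k : ℤ) * C' 1 + k →
                  s((![(k : ℤ) * C' 0, i] : Site 2), ![(k : ℤ) * C' 0, i + 1]) ∈ ω := by
                intro i hi1 hi2
                by_cases hi : i = min (b 1) (c 1)
                · rw [hi]; exact hnew
                · exact hedges i (by omega) (by omega)
              refine Or.inr (Or.inr ⟨C, ![C' 0, C' 1 + 1], hCu,
                hpath.tail (hadjv C' hfull) (mem_univ _), Or.inr ⟨?_, ?_, fun i hi1 hi2 => ?_⟩⟩) <;>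
                simp only [Matrix.cons_val_zero, Matrix.cons_val_one, Matrix.cons_val_fin_one, mul_add, mul_one] at * <;> omega
          · -- interior point of a coarse edge at `kC'`
            have hne1 : c 1 ≠ k * C' 1 + k := fun h => hc1 ⟨C' 1 + 1, by rw [h]; ring⟩
            have hne2 : c 1 ≠ k * C' 1 - k := fun h => hc1 ⟨C' 1 - 1, by rw [h]; ring⟩
            refine Or.inr (Or.inr ⟨C, C', hCu, hpath, Or.inr ⟨by omega, by omega,
              fun i hi1 hi2 => ?_⟩⟩)
            by_cases hi : i = min (b 1) (c 1)
            · rw [hi]; exact hnew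
            · exact hedges i (by omega) (by omega)

/-! ## Long open skeleton walks give long coarse arms -/

/-- **Coarse arm from a long skeleton walk.**  Under the hypotheses of `skeleton_reach`, an open
walk from `u` to `w` with `sup`-displacement `≥ k (L + 2)` yields coarse indices `C`, `C'` with
`kC` within `k - 1` of `u`, `C` joined to `C'` by a `Φ`-open path, and `C' - C ∉ Λ_L`. -/
theorem skeleton_arm {k : ℕ} (hk : 2 ≤ k) {ω : BondConfig (Site 2)}
    (hω : ∀ e ∈ ω, ∃ (v : Site 2) (d : Fin 2),
      e = s(v, v + (if d = 0 then ![1, 0] else ![0, 1])) ∧ (k : ℤ) ∣ v (if d = 0 then 1 else 0))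
    (Φ : BondConfig (Site 2))
    (hΦh : ∀ C : Site 2, (∀ i : ℤ, (k : ℤ) * C 0 ≤ i → i < (k : ℤ) * C 0 + k →
        s((![i, (k : ℤ) * C 1] : Site 2), ![i + 1, (k : ℤ) * C 1]) ∈ ω) → s(C, C + ![1, 0]) ∈ Φ)
    (hΦv : ∀ C : Site 2, (∀ i : ℤ, (k : ℤ) * C 1 ≤ i → i < (k : ℤ) * C 1 + k →
        s((![(k : ℤ) * C 0, i] : Site 2), ![(k : ℤ) * C 0, i + 1]) ∈ ω) → s(C, C + ![0, 1]) ∈ Φ)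
    {u w : Site 2} (h : (openGraph ω).Reachable u w) {L : ℕ}
    (hfar : (k : ℤ) * L + 2 * k ≤ w 0 - u 0 ∨ (k : ℤ) * L + 2 * k ≤ u 0 - w 0 ∨
      (k : ℤ) * L + 2 * k ≤ w 1 - u 1 ∨ (k : ℤ) * L + 2 * k ≤ u 1 - w 1) :
    ∃ C C' : Site 2, ((k : ℤ) * C 0 - k < u 0 ∧ u 0 < k * C 0 + k ∧
        (k : ℤ) * C 1 - k < u 1 ∧ u 1 < k * C 1 + k) ∧
      PathIn (openGraph Φ) univ C C' ∧ C' - C ∉ box 2 L := by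
  have hk0 : (0 : ℤ) < k := by exact_mod_cast (show 0 < k by omega)
  have hk2 : (2 : ℤ) ≤ k := by exact_mod_cast hk
  have hkL : (0 : ℤ) ≤ k * L := by positivity
  have key : ∀ {C C' : Site 2} (j : Fin 2), (k : ℤ) * L < k * (C' j - C j) ∨
      (k : ℤ) * L < k * (C j - C' j) → C' - C ∉ box 2 L := by
    intro C C' j hj hbox
    rw [mem_box] at hbox
    have h1 := hbox j
    simp only [Pi.sub_apply] at h1
    rcases hj with hj | hj
    · have := lt_of_mul_lt_mul_left hj hk0.le; omega
    · have := lt_of_mul_lt_mul_left hj hk0.le; omega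
  have e1 : ∀ C C' : Site 2, ∀ j, (k : ℤ) * (C' j - C j) = k * C' j - k * C j := fun _ _ _ => by ring
  have e2 : ∀ C C' : Site 2, ∀ j, (k : ℤ) * (C j - C' j) = k * C j - k * C' j := fun _ _ _ => by ring
  rcases skeleton_reach hk hω Φ hΦh hΦv h with ⟨rfl, -⟩ | ⟨C, hC⟩ | ⟨C, C', hCu, hpath, hseg⟩
  · exfalso; omega
  · exfalso; rcases hC with hC | hC <;> omega
  · refine ⟨C, C', hCu, hpath, ?_⟩
    have e10 := e1 C C' 0; have e11 := e1 C C' 1; have e20 := e2 C C' 0; have e21 := e2 C C' 1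
    rcases hseg with ⟨hw1, hw0, -⟩ | ⟨hw0, hw1, -⟩ <;> rcases hfar with hf | hf | hf | hf <;>
      first
      | exact key 0 (Or.inl (by omega)) | exact key 0 (Or.inr (by omega))
      | exact key 1 (Or.inl (by omega)) | exact key 1 (Or.inr (by omega))

end Summit.CriticalPhenomena.CardyFormulaZ2.Theorems.CardySelfRefinement

end
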